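import Summits.HodgeConjecture.CorCM.Census.TypeStabiliserCharK

/-!
# Twists `G = ⟨u⟩·B`, `c = u^{2ʲ}`, I: roots of `c`, the type-stabiliser subgroup `𝒦`, and `d₂(G/𝒦) ∈ {0, 1}`

COR-CM (cell `pub-hodgecm2`), count-neutral kernel combinatorics by the binder seat b09 (gen 33; lane COINVARIANT-TWIST, part I of II —
part II `Census/CoinvariantTwistLaw.lean` is THE TWIST FIBRE LAW `φ₂ + 1 + δ = β`), sequel of this seatʼs coinvariant fibre `φ₂`
(`Census/CoinvariantFibre.lean`, `Census/CoinvariantFloor.lean`), of its closed form (`Census/HalfParityCount.lean`, in lit-andre-3ʼs `d₂`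
currency `Census/TypeStabiliserCharK.lean`: `φ₂(G,c) + 1 + [|G|/2 even] = β(G,c) + d₂(G/𝒦)`, `𝒦 = ⟨c, {g | c ∉ ⟨g⟩}⟩` of
`Census/TypeStabiliserSubgroup.lean`, `d₂ = indexTwoRank` of `Census/TypeStabiliserIndexTwoRank.lean`) and of the QUARTIC-TWIST law
(`Census/QuarticTwist*`, gen 32).  Pure group theory, used BY NAME; theorems only (no definition, no `decide`, no certificate, no named
fact, no `sorry`).  HONEST FRAMING: `HC_CM` is NOT proved, here or anywhere in the tree; nothing here is a period or a headline.

THE SETTING («twists», internal form).  A group `G` with a CENTRAL element `u` of order `2ʲ⁺¹` (`j ≥ 0`; `hu`, `hord`) and a subgroup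
`B ≤ G` with `⟨u⟩ ∩ B = 1` (`hdisj`) and `G = ⟨u⟩·B` (`hgen : ∀ g, ∃ i b, b ∈ B ∧ g = uⁱ b`) — i.e. `G ≅ ℤ/2ʲ⁺¹ × B` with `B` ANY
group — and the central involution **`c = u^{2ʲ}`** (`c_mul_c`, `c_ne_one`, `c_comm`).  `j = 0`: `c = u` is complemented (`G = ⟨c⟩ × B`,
the SLICES of the census); `j = 1`: the QUARTIC TWISTS `(ℤ/4 × B, (2,0))` of gen 32 / seat b23ʼs quartic datum
(`Census/ClockTypesDictionary.lean`: `u = θ⁻¹(1,0)`, `B = θ⁻¹(0 × B)`); `j = 2`: the OCTIC TWISTS `(ℤ/8 × B, (4,0))`; … .  Every finite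
ABELIAN pair `(G, c)` (`c` of order two) is of this form (`c = 2ʲγ` with `⟨γ⟩ ≅ ℤ/2ʲ⁺¹` pure, hence a direct summand; lane note
`HOME/pub-hodgecm2-b09/lean-g32/QUARTIC-TWIST.md` PART V; not formalised here).

CONTENT.
* §1 the cyclic `2`-group `⟨u⟩`: **every non-trivial `uⁿ` has `c` among its powers** (`c_mem_zpowers_of_pow_ne_one`: `n = 2ᵉ m`, `m` odd,
  `e ≤ j`, `(uⁿ)^{2^{j−e}} = cᵐ = c`).
* §2 **the root criterion**: for `b ∈ B`, `i ∈ ℕ`, **`c ∈ ⟨uⁱ b⟩ ↔ 2ʲ⁺¹ ∤ i · ord b`** (`c_mem_zpowers_mul_iff`: `(uⁱb)^{ord b} = u^{i·ord b}`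
  is non-trivial iff `2ʲ⁺¹ ∤ i · ord b`; conversely `(uⁱb)ᵏ = c` forces `bᵏ ∈ ⟨u⟩ ∩ B = 1`, `ord b ∣ k`, `u^{ik} = 1 ≠ c`).
* §3 **`𝒦` of a twist**: `B ≤ 𝒦` (`le_stabGen`); some `b ∈ B` with `2ʲ⁺¹ ∣ ord b` ⇒ `u·b` is a non-root ⇒ **`𝒦 = G`**
  (`stabGen_eq_top_of_exists`); `j = 0` ⇒ `c = u ∈ 𝒦` ⇒ `𝒦 = G` (`stabGen_eq_top_of_eq_zero`); `j ≥ 1` and no such `b` ⇒ every non-root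
  `uⁱ b` has `i` even ⇒ **`𝒦 ≤ ⟨u²⟩ ⊔ B`** (`stabGen_le_evenPart`; membership `uⁱ b ∈ ⟨u²⟩ ⊔ B ↔ i even`, `upow_mul_mem_evenPart_iff`),
  the even part has index two (`index_evenPart`) and is the ONLY subgroup of index two over `B` (`eq_evenPart_of_index_two`), so exactly
  one index-two subgroup lies over `𝒦` and **`d₂(G/𝒦) = 1`** (`card_indexTwoOver_stabGen_eq_one`, `indexTwoRank_stabGen_eq_one`); in the
  two other cases `d₂(G/𝒦) = 0` (`indexTwoRank_stabGen_eq_zero_of_exists`, `…_of_eq_zero`).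
* §4 `|G| = 2ʲ⁺¹·|B|` (`card_eq`, the bijection `⟨u⟩ × B → G`), `|G|/2 = 2ʲ·|B|` (`card_div_two`), and Cauchy in `B`
  (`even_card_iff`: `|B|` even iff some `b ∈ B` has even order).

## References
* [Pohlmann1968] H. Pohlmann, Algebraic cycles on abelian varieties of complex multiplication type, Ann. of Math. 88 (1968), Thm 1
  (the Hodge ring of a CM abelian variety of Galois CM type as the `G`-coinvariant lattice; `φ₂`, `β`, `𝒦` are its bookkeeping).
* [Milne1999] J. S. Milne, Lefschetz motives and the Tate conjecture, Compositio Math. 117 (1999), Prop. 2.1, p. 54.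
-/

namespace Summit.HodgeConjecture.CorCM.Census.CoinvariantTwist

open Summit.HodgeConjecture.CorCM.Prior.AllgGroup.RfwfAllgGroup
open Summit.HodgeConjecture.CorCM.Census.BlockParity
open Summit.HodgeConjecture.CorCM.Census.Coinvariant
open Summit.HodgeConjecture.CorCM.Census.TypeStabiliser
open Summit.HodgeConjecture.CorCM.Census.IndexTwo

section GroupOnly

variable {G : Type*} [Group G] {u : G} {j : ℕ} {B : Subgroup G}

/-! ## §1 The cyclic `2`-group `⟨u⟩` and its involution `c = u^{2ʲ}` -/

/-- `uⁿ = 1 ↔ 2ʲ⁺¹ ∣ n` for `u` of order `2ʲ⁺¹`. [folklore] -/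
theorem pow_eq_one_iff_dvd (hord : orderOf u = 2 ^ (j + 1)) (n : ℕ) : u ^ n = 1 ↔ 2 ^ (j + 1) ∣ n := by
  rw [← orderOf_dvd_iff_pow_eq_one, hord]

/-- `c = u^{2ʲ}` is an involution: `c * c = 1`. [folklore] -/
theorem c_mul_c (hord : orderOf u = 2 ^ (j + 1)) : u ^ 2 ^ j * u ^ 2 ^ j = 1 := by
  rw [← pow_add, ← two_mul, ← pow_succ', pow_eq_one_iff_dvd hord]

/-- `c = u^{2ʲ} ≠ 1`. [folklore] -/
theorem c_ne_one (hord : orderOf u = 2 ^ (j + 1)) : u ^ 2 ^ j ≠ 1 :=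
  pow_ne_one_of_lt_orderOf (pow_ne_zero _ two_ne_zero)
    (by rw [hord]; exact Nat.pow_lt_pow_right (by norm_num) (Nat.lt_succ_self j))

/-- `hu` as a `Commute` statement. [folklore] -/
theorem commute_of (hu : ∀ x : G, x * u = u * x) (x : G) : Commute x u := hu x

/-- Powers of a central element are central. [folklore] -/
theorem mul_pow_comm (hu : ∀ x : G, x * u = u * x) (x : G) (n : ℕ) : x * u ^ n = u ^ n * x :=
  ((commute_of hu x).pow_right n).eq

/-- `c = u^{2ʲ}` is central. [folklore] -/
theorem c_comm (hu : ∀ x : G, x * u = u * x) (x : G) : x * u ^ 2 ^ j = u ^ 2 ^ j * x :=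
  mul_pow_comm hu x _

/-- **Every non-trivial element of the cyclic `2`-group `⟨u⟩` has `c` among its powers**: `uⁿ ≠ 1 ⇒ c ∈ ⟨uⁿ⟩`
(write `n = 2ᵉ·m`, `m` odd, `e ≤ j`; then `(uⁿ)^{2^{j−e}} = c^m = c`). [folklore] -/
theorem c_mem_zpowers_of_pow_ne_one (hord : orderOf u = 2 ^ (j + 1)) {n : ℕ} (hn : u ^ n ≠ 1) :
    u ^ 2 ^ j ∈ Subgroup.zpowers (u ^ n) := by
  have hn0 : n ≠ 0 := by
    rintro rfl
    exact hn (pow_zero u)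
  obtain ⟨e, m, hm, rfl⟩ := Nat.exists_eq_two_pow_mul_odd hn0
  have he : e ≤ j := by
    by_contra h
    apply hn
    rw [pow_eq_one_iff_dvd hord]
    exact Dvd.dvd.mul_right (pow_dvd_pow 2 (by omega)) m
  obtain ⟨k, rfl⟩ := hm
  have hexp : 2 ^ e * (2 * k + 1) * 2 ^ (j - e) = k * 2 ^ (j + 1) + 2 ^ j := by
    have h2 : 2 ^ e * 2 ^ (j - e) = 2 ^ j := by rw [← pow_add, Nat.add_sub_cancel' he]
    calc 2 ^ e * (2 * k + 1) * 2 ^ (j - e) = (2 * k + 1) * (2 ^ e * 2 ^ (j - e)) := by ring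
      _ = (2 * k + 1) * 2 ^ j := by rw [h2]
      _ = k * 2 ^ (j + 1) + 2 ^ j := by ring
  have key : (u ^ (2 ^ e * (2 * k + 1))) ^ 2 ^ (j - e) = u ^ 2 ^ j := by
    rw [← pow_mul, hexp, pow_add, pow_mul', (pow_eq_one_iff_dvd hord _).mpr (dvd_refl _), one_pow, one_mul]
  rw [← key]
  exact Subgroup.pow_mem _ (Subgroup.mem_zpowers _) _

/-! ## §2 Roots of `c` in `G = ⟨u⟩·B`: `c ∈ ⟨uⁱ b⟩ ↔ 2ʲ⁺¹ ∤ i · ord b` -/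

/-- `u` commutes with everything, so `(uⁱ b)ⁿ = u^{i n} bⁿ`. [folklore] -/
theorem upow_mul_pow (hu : ∀ x : G, x * u = u * x) (i : ℕ) (b : G) (n : ℕ) :
    (u ^ i * b) ^ n = u ^ (i * n) * b ^ n := by
  rw [((commute_of hu b).symm.pow_left i).mul_pow, pow_mul]

/-- `uⁱ` lies in `⟨u⟩` (integer powers too). [folklore] -/
theorem upow_zpow_mem_zpowers (i : ℕ) (k : ℤ) : (u ^ i) ^ k ∈ Subgroup.zpowers u :=
  Subgroup.zpow_mem _ (Subgroup.pow_mem _ (Subgroup.mem_zpowers u) i) k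

/-- **The root criterion**: for `b ∈ B` (`⟨u⟩ ∩ B = 1`, `u` central of order `2ʲ⁺¹`),
**`c ∈ ⟨uⁱ b⟩ ↔ 2ʲ⁺¹ ∤ i · ord b`**. [folklore] -/
theorem c_mem_zpowers_mul_iff (hu : ∀ x : G, x * u = u * x) (hord : orderOf u = 2 ^ (j + 1))
    (hdisj : ∀ g : G, g ∈ Subgroup.zpowers u → g ∈ B → g = 1) {b : G} (hb : b ∈ B) (i : ℕ) :
    u ^ 2 ^ j ∈ Subgroup.zpowers (u ^ i * b) ↔ ¬ 2 ^ (j + 1) ∣ i * orderOf b := by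
  have hcomm : Commute (u ^ i) b := (commute_of hu b).symm.pow_left i
  constructor
  · intro hc hdvd
    obtain ⟨k, hk⟩ := Subgroup.mem_zpowers_iff.mp hc
    rw [hcomm.mul_zpow] at hk
    have hbk : b ^ k = (u ^ i) ^ (-k) * u ^ 2 ^ j := by
      rw [← hk, ← mul_assoc, ← zpow_add, neg_add_cancel, zpow_zero, one_mul]
    have hbku : b ^ k ∈ Subgroup.zpowers u := by
      rw [hbk]
      exact Subgroup.mul_mem _ (upow_zpow_mem_zpowers i (-k)) (Subgroup.pow_mem _ (Subgroup.mem_zpowers u) _)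
    have hbk1 : b ^ k = 1 := hdisj _ hbku (Subgroup.zpow_mem B hb k)
    obtain ⟨q, hq⟩ := orderOf_dvd_iff_zpow_eq_one.mpr hbk1
    have h1 : u ^ (i * orderOf b) = 1 := (pow_eq_one_iff_dvd hord _).mpr hdvd
    have huk : (u ^ i) ^ k = 1 := by
      rw [hq, ← zpow_natCast, ← zpow_mul, ← mul_assoc, ← Nat.cast_mul, zpow_mul, zpow_natCast, h1, one_zpow]
    rw [huk, hbk1, mul_one] at hk
    exact c_ne_one hord hk.symm
  · intro hndvd
    have hne : u ^ (i * orderOf b) ≠ 1 := fun h => hndvd ((pow_eq_one_iff_dvd hord _).mp h)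
    have hmem : u ^ (i * orderOf b) ∈ Subgroup.zpowers (u ^ i * b) := by
      have h : (u ^ i * b) ^ orderOf b = u ^ (i * orderOf b) := by
        rw [upow_mul_pow hu, pow_orderOf_eq_one, mul_one]
      rw [← h]
      exact Subgroup.pow_mem _ (Subgroup.mem_zpowers _) _
    exact Subgroup.zpowers_le.mpr hmem (c_mem_zpowers_of_pow_ne_one hord hne)

/-! ## §3 The type-stabiliser subgroup `𝒦 = ⟨c, non-roots⟩` of a twist -/

/-- **`B ≤ 𝒦`**: no element of `B` is a root of `c` (`⟨b⟩ ≤ B` misses `c ∈ ⟨u⟩ ∖ 1`). [folklore] -/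
theorem le_stabGen (hord : orderOf u = 2 ^ (j + 1)) (hdisj : ∀ g : G, g ∈ Subgroup.zpowers u → g ∈ B → g = 1) :
    B ≤ stabGen (u ^ 2 ^ j) := fun _ hb =>
  mem_stabGen_of_notMem_zpowers _ fun h =>
    c_ne_one hord (hdisj _ (Subgroup.pow_mem _ (Subgroup.mem_zpowers u) _) (Subgroup.zpowers_le.mpr hb h))

/-- `u ∈ 𝒦 ⇒ 𝒦 = G` (as `G = ⟨u⟩·B` and `B ≤ 𝒦`). [folklore] -/
theorem stabGen_eq_top_of_mem (hord : orderOf u = 2 ^ (j + 1)) (hdisj : ∀ g : G, g ∈ Subgroup.zpowers u → g ∈ B → g = 1)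
    (hgen : ∀ g : G, ∃ i : ℕ, ∃ b ∈ B, g = u ^ i * b) (huK : u ∈ stabGen (u ^ 2 ^ j)) : stabGen (u ^ 2 ^ j) = ⊤ := by
  rw [eq_top_iff]
  intro g _
  obtain ⟨i, b, hb, rfl⟩ := hgen g
  exact Subgroup.mul_mem _ (Subgroup.pow_mem _ huK i) (le_stabGen hord hdisj hb)

/-- **An element `b ∈ B` of order divisible by `2ʲ⁺¹` makes `𝒦 = G`**: `u·b` is a non-root of `c`. [folklore] -/
theorem stabGen_eq_top_of_exists (hu : ∀ x : G, x * u = u * x) (hord : orderOf u = 2 ^ (j + 1))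
    (hdisj : ∀ g : G, g ∈ Subgroup.zpowers u → g ∈ B → g = 1) (hgen : ∀ g : G, ∃ i : ℕ, ∃ b ∈ B, g = u ^ i * b)
    (h : ∃ b ∈ B, 2 ^ (j + 1) ∣ orderOf b) : stabGen (u ^ 2 ^ j) = ⊤ := by
  obtain ⟨b, hb, hdvd⟩ := h
  apply stabGen_eq_top_of_mem hord hdisj hgen
  have h1 : u ^ 1 * b ∈ stabGen (u ^ 2 ^ j) :=
    mem_stabGen_of_notMem_zpowers _ fun hc => (c_mem_zpowers_mul_iff hu hord hdisj hb 1).mp hc (by rwa [one_mul])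
  have h2 := Subgroup.mul_mem _ h1 (Subgroup.inv_mem _ (le_stabGen hord hdisj hb))
  rwa [pow_one, mul_inv_cancel_right] at h2

/-- **`j = 0` makes `𝒦 = G`**: `c = u`. [folklore] -/
theorem stabGen_eq_top_of_eq_zero (hord : orderOf u = 2 ^ (j + 1))
    (hdisj : ∀ g : G, g ∈ Subgroup.zpowers u → g ∈ B → g = 1) (hgen : ∀ g : G, ∃ i : ℕ, ∃ b ∈ B, g = u ^ i * b)
    (hj : j = 0) : stabGen (u ^ 2 ^ j) = ⊤ := by
  apply stabGen_eq_top_of_mem hord hdisj hgen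
  have h := self_mem_stabGen (u ^ 2 ^ j)
  nth_rw 2 [hj] at h
  rwa [pow_zero, pow_one] at h

/-- `⟨u²⟩` is a normal subgroup (`u` central). [folklore] -/
theorem zpowers_sq_normal (hu : ∀ x : G, x * u = u * x) : (Subgroup.zpowers (u ^ 2)).Normal := by
  refine ⟨fun n hn g => ?_⟩
  obtain ⟨k, rfl⟩ := Subgroup.mem_zpowers_iff.mp hn
  have hc : g * (u ^ 2) ^ k = (u ^ 2) ^ k * g := (((commute_of hu g).pow_right 2).zpow_right k).eq
  rw [hc, mul_inv_cancel_right]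
  exact Subgroup.zpow_mem _ (Subgroup.mem_zpowers _) k

/-- Membership in the EVEN PART `⟨u²⟩ ⊔ B`: `g ∈ ⟨u²⟩ ⊔ B ↔ ∃ k b, b ∈ B ∧ g = (u²)ᵏ b`. [folklore] -/
theorem mem_evenPart_iff (hu : ∀ x : G, x * u = u * x) (g : G) :
    g ∈ Subgroup.zpowers (u ^ 2) ⊔ B ↔ ∃ k : ℤ, ∃ b ∈ B, g = (u ^ 2) ^ k * b := by
  haveI := zpowers_sq_normal hu
  rw [← SetLike.mem_coe, Subgroup.normal_mul, Set.mem_mul]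
  constructor
  · rintro ⟨y, hy, b, hb, rfl⟩
    obtain ⟨k, rfl⟩ := Subgroup.mem_zpowers_iff.mp hy
    exact ⟨k, b, hb, rfl⟩
  · rintro ⟨k, b, hb, rfl⟩
    exact ⟨(u ^ 2) ^ k, Subgroup.zpow_mem _ (Subgroup.mem_zpowers _) k, b, hb, rfl⟩

/-- **`uⁱ b ∈ ⟨u²⟩ ⊔ B ↔ i` even** (`b ∈ B`; uses `⟨u⟩ ∩ B = 1` and `ord u = 2ʲ⁺¹` even). [folklore] -/
theorem upow_mul_mem_evenPart_iff (hu : ∀ x : G, x * u = u * x) (hord : orderOf u = 2 ^ (j + 1))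
    (hdisj : ∀ g : G, g ∈ Subgroup.zpowers u → g ∈ B → g = 1) {b : G} (hb : b ∈ B) (i : ℕ) :
    u ^ i * b ∈ Subgroup.zpowers (u ^ 2) ⊔ B ↔ Even i := by
  rw [mem_evenPart_iff hu]
  constructor
  · rintro ⟨k, b', hb', h⟩
    -- `(uⁱ)⁻¹ (u²)ᵏ = b b'⁻¹ ∈ ⟨u⟩ ∩ B = 1`
    have hw : (u ^ i)⁻¹ * (u ^ 2) ^ k = b * b'⁻¹ := by
      rw [eq_mul_inv_iff_mul_eq, mul_assoc, ← h, inv_mul_cancel_left]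
    have hw1 : (u ^ i)⁻¹ * (u ^ 2) ^ k = 1 :=
      hdisj _ (Subgroup.mul_mem _ (Subgroup.inv_mem _ (Subgroup.pow_mem _ (Subgroup.mem_zpowers u) i))
        (Subgroup.zpow_mem _ (Subgroup.pow_mem _ (Subgroup.mem_zpowers u) 2) k))
        (by rw [hw]; exact B.mul_mem hb (B.inv_mem hb'))
    rw [inv_mul_eq_one, ← zpow_natCast, ← zpow_natCast, ← zpow_mul, zpow_eq_zpow_iff_modEq, hord] at hw1
    have hd := (Int.ModEq.dvd hw1)
    -- `2^(j+1) ∣ 2k - i` in `ℤ`, hence `2 ∣ i`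
    have h2 : (2 : ℤ) ∣ (i : ℤ) := by
      have h2' : (2 : ℤ) ∣ ((2 ^ (j + 1) : ℕ) : ℤ) := by
        rw [Nat.cast_pow, Nat.cast_ofNat, pow_succ]
        exact Dvd.intro_left _ rfl
      have h3 : (2 : ℤ) ∣ ((2 : ℕ) : ℤ) * k - (i : ℤ) := h2'.trans hd
      have h4 : (2 : ℤ) ∣ ((2 : ℕ) : ℤ) * k := Dvd.intro _ (by push_cast; ring)
      exact (dvd_sub_right h4).mp h3
    exact even_iff_two_dvd.mpr (by exact_mod_cast h2)
  · rintro ⟨i', rfl⟩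
    exact ⟨i', b, hb, by rw [← two_mul, pow_mul, zpow_natCast]⟩

/-- `c = u^{2ʲ} ∈ ⟨u²⟩ ⊔ B` as soon as `j ≥ 1`. [folklore] -/
theorem c_mem_evenPart (hj : 1 ≤ j) : u ^ 2 ^ j ∈ Subgroup.zpowers (u ^ 2) ⊔ B := by
  apply Subgroup.mem_sup_left
  have h : u ^ 2 ^ j = (u ^ 2) ^ 2 ^ (j - 1) := by
    rw [← pow_mul, ← pow_succ', Nat.sub_add_cancel hj]
  rw [h]
  exact Subgroup.pow_mem _ (Subgroup.mem_zpowers _) _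

/-- **`𝒦 ≤ ⟨u²⟩ ⊔ B` when `j ≥ 1` and no element of `B` has order divisible by `2ʲ⁺¹`**: then every non-root `uⁱ b` of `c` has
`2ʲ⁺¹ ∣ i · ord b` with `2ʲ⁺¹ ∤ ord b`, so `i` is even. [folklore] -/
theorem stabGen_le_evenPart (hu : ∀ x : G, x * u = u * x) (hord : orderOf u = 2 ^ (j + 1))
    (hdisj : ∀ g : G, g ∈ Subgroup.zpowers u → g ∈ B → g = 1) (hgen : ∀ g : G, ∃ i : ℕ, ∃ b ∈ B, g = u ^ i * b)
    (hj : 1 ≤ j) (hB : ∀ b ∈ B, ¬ 2 ^ (j + 1) ∣ orderOf b) :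
    stabGen (u ^ 2 ^ j) ≤ Subgroup.zpowers (u ^ 2) ⊔ B := by
  rw [stabGen_le_iff_subset]
  refine ⟨c_mem_evenPart hj, fun g hg => ?_⟩
  obtain ⟨i, b, hb, rfl⟩ := hgen g
  rw [upow_mul_mem_evenPart_iff hu hord hdisj hb]
  have hdvd : 2 ^ (j + 1) ∣ i * orderOf b := by
    by_contra h
    exact hg ((c_mem_zpowers_mul_iff hu hord hdisj hb i).mpr h)
  by_contra hodd
  rw [Nat.not_even_iff_odd] at hodd
  have hcop : Nat.Coprime (2 ^ (j + 1)) i := Nat.Coprime.pow_left _ (Nat.coprime_two_left.mpr hodd)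
  exact hB b hb (hcop.dvd_of_dvd_mul_left hdvd)

/-- **The even part has index two** (witness `u`: `uⁱ b · u = uⁱ⁺¹ b`). [folklore] -/
theorem index_evenPart (hu : ∀ x : G, x * u = u * x) (hord : orderOf u = 2 ^ (j + 1))
    (hdisj : ∀ g : G, g ∈ Subgroup.zpowers u → g ∈ B → g = 1) (hgen : ∀ g : G, ∃ i : ℕ, ∃ b ∈ B, g = u ^ i * b) :
    (Subgroup.zpowers (u ^ 2) ⊔ B).index = 2 := by
  rw [Subgroup.index_eq_two_iff]
  refine ⟨u, fun g => ?_⟩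
  obtain ⟨i, b, hb, rfl⟩ := hgen g
  have hgu : u ^ i * b * u = u ^ (i + 1) * b := by rw [mul_assoc, hu b, ← mul_assoc, ← pow_succ]
  rw [hgu, upow_mul_mem_evenPart_iff hu hord hdisj hb, upow_mul_mem_evenPart_iff hu hord hdisj hb, Nat.even_add_one]
  by_cases h : Even i
  · exact Or.inr ⟨h, not_not.mpr h⟩
  · exact Or.inl ⟨h, h⟩

/-- A subgroup of index two over `B` does not contain `u` (else it is all of `G = ⟨u⟩·B`). [folklore] -/
theorem not_mem_of_index_two (hgen : ∀ g : G, ∃ i : ℕ, ∃ b ∈ B, g = u ^ i * b) {H : Subgroup G} (hH : H.index = 2)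
    (hBH : B ≤ H) : u ∉ H := by
  intro huH
  have htop : H = ⊤ := by
    rw [eq_top_iff]
    intro g _
    obtain ⟨i, b, hb, rfl⟩ := hgen g
    exact H.mul_mem (H.pow_mem huH i) (hBH hb)
  rw [htop, Subgroup.index_top] at hH
  exact absurd hH (by norm_num)

/-- **The even part is the ONLY subgroup of index two over `B`**: such an `H` contains `u² ` (index two) and `B`, hence the even part,
of the same index. [folklore] -/
theorem eq_evenPart_of_index_two (hu : ∀ x : G, x * u = u * x) (hord : orderOf u = 2 ^ (j + 1))
    (hdisj : ∀ g : G, g ∈ Subgroup.zpowers u → g ∈ B → g = 1) (hgen : ∀ g : G, ∃ i : ℕ, ∃ b ∈ B, g = u ^ i * b)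
    {H : Subgroup G} (hH : H.index = 2) (hBH : B ≤ H) : H = Subgroup.zpowers (u ^ 2) ⊔ B := by
  have hle : Subgroup.zpowers (u ^ 2) ⊔ B ≤ H :=
    sup_le (Subgroup.zpowers_le.mpr (by rw [pow_two]; exact Subgroup.mul_self_mem_of_index_two hH u)) hBH
  have hrel := Subgroup.relIndex_mul_index hle
  rw [hH, index_evenPart hu hord hdisj hgen] at hrel
  have h1 : (Subgroup.zpowers (u ^ 2) ⊔ B).relIndex H = 1 := by omega
  exact le_antisymm (Subgroup.relIndex_eq_one.mp h1) hle

/-- **Exactly one subgroup of index two lies over `𝒦`** when `j ≥ 1` and no element of `B` has order divisible by `2ʲ⁺¹`. [folklore] -/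
theorem card_indexTwoOver_stabGen_eq_one (hu : ∀ x : G, x * u = u * x) (hord : orderOf u = 2 ^ (j + 1))
    (hdisj : ∀ g : G, g ∈ Subgroup.zpowers u → g ∈ B → g = 1) (hgen : ∀ g : G, ∃ i : ℕ, ∃ b ∈ B, g = u ^ i * b)
    (hj : 1 ≤ j) (hB : ∀ b ∈ B, ¬ 2 ^ (j + 1) ∣ orderOf b) :
    Nat.card {H : Subgroup G // H.index = 2 ∧ stabGen (u ^ 2 ^ j) ≤ H} = 1 := by
  rw [Nat.card_eq_one_iff_exists]
  refine ⟨⟨Subgroup.zpowers (u ^ 2) ⊔ B, index_evenPart hu hord hdisj hgen, stabGen_le_evenPart hu hord hdisj hgen hj hB⟩, ?_⟩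
  rintro ⟨H, hH, hKH⟩
  exact Subtype.ext (eq_evenPart_of_index_two hu hord hdisj hgen hH ((le_stabGen hord hdisj).trans hKH))

/-- **`d₂(G/𝒦) = 1`** when `j ≥ 1` and no element of `B` has order divisible by `2ʲ⁺¹`. [folklore] -/
theorem indexTwoRank_stabGen_eq_one [Finite G] (hu : ∀ x : G, x * u = u * x) (hord : orderOf u = 2 ^ (j + 1))
    (hdisj : ∀ g : G, g ∈ Subgroup.zpowers u → g ∈ B → g = 1) (hgen : ∀ g : G, ∃ i : ℕ, ∃ b ∈ B, g = u ^ i * b)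
    (hj : 1 ≤ j) (hB : ∀ b ∈ B, ¬ 2 ^ (j + 1) ∣ orderOf b) : indexTwoRank (stabGen (u ^ 2 ^ j)) = 1 := by
  have h := two_pow_indexTwoRank_stabGen (u ^ 2 ^ j) (c_comm hu)
  rw [card_indexTwoOver_stabGen_eq_one hu hord hdisj hgen hj hB] at h
  exact Nat.pow_right_injective (le_refl 2) (h.trans (pow_one 2).symm)

/-- **`d₂(G/𝒦) = 0`** when some element of `B` has order divisible by `2ʲ⁺¹` (`𝒦 = G`). [folklore] -/
theorem indexTwoRank_stabGen_eq_zero_of_exists (hu : ∀ x : G, x * u = u * x) (hord : orderOf u = 2 ^ (j + 1))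
    (hdisj : ∀ g : G, g ∈ Subgroup.zpowers u → g ∈ B → g = 1) (hgen : ∀ g : G, ∃ i : ℕ, ∃ b ∈ B, g = u ^ i * b)
    (hB : ∃ b ∈ B, 2 ^ (j + 1) ∣ orderOf b) : indexTwoRank (stabGen (u ^ 2 ^ j)) = 0 := by
  rw [stabGen_eq_top_of_exists hu hord hdisj hgen hB]
  exact indexTwoRank_top

/-- **`d₂(G/𝒦) = 0`** when `j = 0` (`c = u`, `𝒦 = G`). [folklore] -/
theorem indexTwoRank_stabGen_eq_zero_of_eq_zero (hord : orderOf u = 2 ^ (j + 1))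
    (hdisj : ∀ g : G, g ∈ Subgroup.zpowers u → g ∈ B → g = 1) (hgen : ∀ g : G, ∃ i : ℕ, ∃ b ∈ B, g = u ^ i * b)
    (hj : j = 0) : indexTwoRank (stabGen (u ^ 2 ^ j)) = 0 := by
  rw [stabGen_eq_top_of_eq_zero hord hdisj hgen hj]
  exact indexTwoRank_top

/-! ## §4 The order of `G = ⟨u⟩·B` and the parity of `|G|/2` -/

/-- **`|G| = 2ʲ⁺¹ · |B|`**: `⟨u⟩ × B → G`, `(w, b) ↦ w b` is a bijection. [folklore] -/
theorem card_eq (hord : orderOf u = 2 ^ (j + 1)) (hdisj : ∀ g : G, g ∈ Subgroup.zpowers u → g ∈ B → g = 1)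
    (hgen : ∀ g : G, ∃ i : ℕ, ∃ b ∈ B, g = u ^ i * b) : Nat.card G = 2 ^ (j + 1) * Nat.card B := by
  have hbij : Function.Bijective (fun p : Subgroup.zpowers u × B => (p.1 : G) * (p.2 : G)) := by
    constructor
    · rintro ⟨⟨w, hw⟩, ⟨b, hb⟩⟩ ⟨⟨w', hw'⟩, ⟨b', hb'⟩⟩ h
      have h' : w * b = w' * b' := h
      have hq : w'⁻¹ * w = b' * b⁻¹ := by
        rw [eq_mul_inv_iff_mul_eq, mul_assoc, h', inv_mul_cancel_left]
      have hq1 : w'⁻¹ * w = 1 :=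
        hdisj _ ((Subgroup.zpowers u).mul_mem ((Subgroup.zpowers u).inv_mem hw') hw)
          (by rw [hq]; exact B.mul_mem hb' (B.inv_mem hb))
      have hw_eq : w' = w := inv_mul_eq_one.mp hq1
      have hb_eq : b' = b := by
        rw [hq1] at hq
        exact mul_inv_eq_one.mp hq.symm
      subst hw_eq hb_eq
      rfl
    · intro g
      obtain ⟨i, b, hb, rfl⟩ := hgen g
      exact ⟨(⟨u ^ i, Subgroup.pow_mem _ (Subgroup.mem_zpowers u) i⟩, ⟨b, hb⟩), rfl⟩
  rw [← Nat.card_congr (Equiv.ofBijective _ hbij), Nat.card_prod, Nat.card_zpowers, hord]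

/-- **`|G|/2 = 2ʲ · |B|`.** [folklore] -/
theorem card_div_two [Fintype G] (hord : orderOf u = 2 ^ (j + 1))
    (hdisj : ∀ g : G, g ∈ Subgroup.zpowers u → g ∈ B → g = 1) (hgen : ∀ g : G, ∃ i : ℕ, ∃ b ∈ B, g = u ^ i * b) :
    Fintype.card G / 2 = 2 ^ j * Nat.card B := by
  rw [← Nat.card_eq_fintype_card, card_eq hord hdisj hgen, pow_succ, mul_comm (2 ^ j) 2, mul_assoc,
    Nat.mul_div_cancel_left _ two_pos]

/-- **Cauchy in `B`**: `|B|` is even iff some `b ∈ B` has even order. [folklore] -/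
theorem even_card_iff [Finite G] : Even (Nat.card B) ↔ ∃ b ∈ B, 2 ∣ orderOf b := by
  constructor
  · intro h
    obtain ⟨x, hx⟩ := exists_prime_orderOf_dvd_card' 2 (even_iff_two_dvd.mp h)
    exact ⟨x, x.2, by rw [Subgroup.orderOf_coe, hx]⟩
  · rintro ⟨b, hb, h2⟩
    exact even_iff_two_dvd.mpr (h2.trans (Subgroup.orderOf_dvd_natCard B hb))

end GroupOnly

end Summit.HodgeConjecture.CorCM.Census.CoinvariantTwist
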